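import Summits.BirchSwinnertonDyer.BirchSwinnertonDyer.Theorems.SoloInformedJointUniform
import Literature.NumberTheory.EllipticCurves.BertrandCMHeightNonvanishing
import Literature.NumberTheory.EllipticCurves.OrdinaryPrimes
import Literature.NumberTheory.EllipticCurves.CanonicalPAdicHeight
import HarnessLib

/-!
# SoloInformedCMRankOne — the joint mechanism runs unconditionally for CM curves of analytic rank one

`SoloInformedJointGrossZagier` derived, for one curve `E/ℚ` of analytic rank `r` at one good
ordinary prime `p ≥ 5`, the conclusion `rank E(ℚ) = r ∧ corank Ш(E/ℚ)[p^∞] = 0 ∧ ord_T L_p = r`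
(`soloInformedJoint_rank_eq`) from: the joint Gross–Zagier identity `(ZZ_r)`, modularity, Kato's
divisibility `corank Sel_{p^∞} ≤ ord_T L_p`, and non-degeneracy of the canonical `p`-adic height
on Néron–Tate-independent `r`-families ("Schneider on the Gross–Zagier lattice"). At `r = 1` the
first input is Perrin-Riou's theorem (`soloInformedJoint_one_of_perrinRiou`), and for curves with
complex multiplication the last input is BERTRAND's theorem (`bertrand_pairing_self_ne_zero_of_hasCM`,
Bertrand 1984, §3 Cor. 1: `ĥ_p(P) ≠ 0` for non-torsion `P` on a CM curve at a good ordinary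
`p ≥ 5`, via Wüstholz's analytic subgroup theorem). So for CM curves of analytic rank one every
hypothesis of the joint mechanism is a theorem in print, and the mechanism yields

* `soloInformedCM_rank_eq_one`: `E/ℚ` CM, `ord_{s=1} L(E,s) = 1`, `p ≥ 5` good ordinary ⇒
  `rank E(ℚ) = 1`, `Ш(E/ℚ)[p^∞]` finite (corank `0`) and `ord_T L_p(E,T) = 1` — from Perrin-Riou +
  Bertrand + Kato + modularity, with NO appeal to Kolyvagin's Euler system of Heegner points or to
  Rubin's of elliptic units (the Heegner point enters only through Perrin-Riou's formula). This is
  the known CM case (Perrin-Riou 1987 §1.4 gives `rank ≥ 1`; finiteness of `Ш[p^∞]` is Rubin 1987 /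
  Kolyvagin 1988 in print, here replaced by Kato's 2004 divisibility); it is recorded as the
  DEMONSTRATION RUNG of the joint receptacle: the one setting where its `p`-adic leg is discharged.
* `soloInformedCM_padicRegulatorOf_fin_one_ne_zero`: `PAdicHeightAnisotropic` restricted to
  one-point families on CM curves is Bertrand's theorem (`det⟨P,P⟩_D = ĥ_p(P)`, and `ĥ(P) ≠ 0`
  forces `P` non-torsion since the Néron–Tate pairing kills torsion).
* `soloInformedCM_somewhere_fin_one`: hence `PAdicHeightSomewhereNondegenerate` for one-point
  families on CM curves, given the supply of one good ordinary `p ≥ 5` (`exists_good_ordinary_prime`,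
  Serre 1981 §8 / Deuring) and of the canonical datum (`exists_isCanonical`).

Beyond one point nothing is known: Bertrand's paper disclaims non-degeneracy in rank `≥ 2`
(end of §3), which is exactly the open `p`-adic leg of `(ZZ_2)`.
-/

noncomputable section

open scoped Classical MatrixGroups ModularForm

open CongruenceSubgroup Literature.NumberTheory.EllipticCurves
  Literature.NumberTheory.EllipticCurves.ModularForms WeierstrassCurve WeierstrassCurve.Affine.Point
  Matrix

namespace Summit.BirchSwinnertonDyer.BirchSwinnertonDyer.Theorems

/-- **Bertrand = anisotropy on one-point families of CM curves.** For `E/ℚ` with complex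
multiplication (globally minimal `W`), a good ordinary prime `p ≥ 5`, the canonical datum `D` and
a one-point family `P` with `det⟨P,P⟩_NT = ĥ(P 0) ≠ 0`: `det⟨P,P⟩_D = ĥ_p(P 0) ≠ 0`. The point is
non-torsion because the Néron–Tate pairing kills torsion
(`soloInformedJoint_heightPairing_eq_zero_of_isOfFinAddOrder`); then Bertrand 1984, §3 Cor. 1.
[cite: Bertrand1984ThetaCM, §3 Corollaire 1 (p. 21)] -/
theorem soloInformedCM_padicRegulatorOf_fin_one_ne_zero (hBer : bertrand_pairing_self_ne_zero_of_hasCM)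
    (W : WeierstrassCurve ℚ) [W.IsElliptic] [W.IsGloballyMinimal] (hCM : W.HasCM)
    (p : ℕ) [Fact p.Prime] (hp : 5 ≤ p) (hord : IsOrdinaryAt W p)
    (D : WeierstrassCurve.PAdicHeightData W p) (hD : D.IsCanonical)
    (P : Fin 1 → W.toAffine.Point) (hReg : regulatorOf P ≠ 0) : padicRegulatorOf D P ≠ 0 := by
  rw [soloInformedJoint_padicRegulatorOf_fin_one]
  refine hBer W hCM p hp hord.1 hord.2 D hD (P 0) ?_
  intro hT
  apply hReg
  rw [soloInformedJoint_regulatorOf_fin_one, ← heightPairing_self_holds (P 0)]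
  exact soloInformedJoint_heightPairing_eq_zero_of_isOfFinAddOrder _ _ (by convert hT)

/-- **Somewhere-non-degeneracy for one-point families on CM curves.** With the supply of one good
ordinary prime `p ≥ 5` (`exists_good_ordinary_prime`; Deuring: for CM curves the ordinary primes
are those split in the CM field, density `1/2`) and of the canonical datum (`exists_isCanonical`),
Bertrand's theorem gives `PAdicHeightSomewhereNondegenerate` restricted to `r = 1` and CM `W`.
[cite: Bertrand1984ThetaCM, §3 Corollaire 1 (p. 21)] -/
theorem soloInformedCM_somewhere_fin_one (hBer : bertrand_pairing_self_ne_zero_of_hasCM)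
    (hOrd : WeierstrassCurve.exists_good_ordinary_prime) (hCan : exists_isCanonical)
    (W : WeierstrassCurve ℚ) [W.IsElliptic] [W.IsGloballyMinimal] (hCM : W.HasCM)
    (P : Fin 1 → W.toAffine.Point) (hReg : regulatorOf P ≠ 0) :
    ∃ (p : ℕ) (_ : Fact p.Prime) (D : WeierstrassCurve.PAdicHeightData W p),
      5 ≤ p ∧ IsOrdinaryAt W p ∧ D.IsCanonical ∧ padicRegulatorOf D P ≠ 0 := by
  obtain ⟨p, hpF, hp5, hgood, hnd⟩ := hOrd W
  obtain ⟨D, hD⟩ := hCan W p hp5 hgood hnd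
  exact ⟨p, hpF, D, hp5, ⟨hgood, hnd⟩, hD,
    soloInformedCM_padicRegulatorOf_fin_one_ne_zero hBer W hCM p hp5 ⟨hgood, hnd⟩ D hD P hReg⟩

/-- **CM curves of analytic rank one: rank, `Ш[p^∞]` and `ord_T L_p` from Perrin-Riou, Bertrand
and Kato.** Let `E/ℚ` (globally minimal `W`) have complex multiplication and `ord_{s=1} L(E,s) = 1`,
let `p ≥ 5` be good ordinary, `D` the canonical `p`-adic height datum and `f` the newform of `E`.
From Perrin-Riou's prime-wise leading-term theorem (`perrinRiou_rankOne_leadingTerms`, giving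
`(ZZ_1)`), modularity (`hasEntireLFunction_rat`: `L'(E,1) ≠ 0`), Kato's divisibility
`corank Sel_{p^∞} ≤ ord_T L_p` and Bertrand's `ĥ_p(P) ≠ 0`:
`rank E(ℚ) = 1`, `corank_{ℤ_p} Ш(E/ℚ)[p^∞] = 0` and `ord_{T=0} L_p(E,T) = 1` — the joint mechanism
`soloInformedJoint_rank_eq` with every hypothesis discharged by a theorem in print; no Euler
system of Heegner points (Kolyvagin) or elliptic units (Rubin) is invoked. Known result
(Perrin-Riou 1987 §1.4 with Rubin 1987); recorded as the demonstration rung of the receptacle.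
[cite: PerrinRiou1987, Thm. 1.3 and §1.4 Cor. 1.8] -/
theorem soloInformedCM_rank_eq_one (hPR : perrinRiou_rankOne_leadingTerms)
    (hE : hasEntireLFunction_rat) (hBer : bertrand_pairing_self_ne_zero_of_hasCM)
    (W : WeierstrassCurve ℚ) [W.IsElliptic] [W.IsGloballyMinimal] (hCM : W.HasCM)
    (h1 : W.analyticRank = 1) (p : ℕ) [Fact p.Prime] (hp : 5 ≤ p) (hord : IsOrdinaryAt W p)
    (D : WeierstrassCurve.PAdicHeightData W p) (hD : D.IsCanonical)
    {N : ℕ} [NeZero N] (f : CuspForm (Gamma0 N) 2) (hf : IsNewformOf W f)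
    (hKato : kato_selmerCorank_le_order_padicLFunction W p (f := f)) :
    W.mordellWeilRank = 1 ∧ W.shaCorank p = 0 ∧
      (padicLFunction f (unitRoot W p : ℚ_[p])).order = 1 :=
  soloInformedJoint_rank_eq W p f (soloInformedJoint_one_of_perrinRiou hPR) hE hp hord h1 D hD hf
    hKato (fun P hReg =>
      soloInformedCM_padicRegulatorOf_fin_one_ne_zero hBer W hCM p hp hord D hD P hReg)

/-- **The RANK conjecture for CM curves of analytic rank one, from the joint mechanism.** Same
inputs plus the supply facts (one good ordinary `p ≥ 5`, its canonical datum, the newform of `E`: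
`exists_isNewformOf`) and Kato at every prime: `r_an(E) = 1 ⇒ rank E(ℚ) = 1` for CM `E`
(globally minimal model). [cite: PerrinRiou1987, Thm. 1.3 and §1.4 Cor. 1.8] -/
theorem soloInformedCM_rank_eq_analyticRank_of_one (hPR : perrinRiou_rankOne_leadingTerms)
    (hE : hasEntireLFunction_rat) (hBer : bertrand_pairing_self_ne_zero_of_hasCM)
    (hOrd : WeierstrassCurve.exists_good_ordinary_prime) (hCan : exists_isCanonical)
    (hMod : exists_isNewformOf)
    (W : WeierstrassCurve ℚ) [W.IsElliptic] [W.IsGloballyMinimal] (hCM : W.HasCM)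
    (hKato : ∀ (p : ℕ) [Fact p.Prime] {N : ℕ} [NeZero N] {f : CuspForm (Gamma0 N) 2},
      kato_selmerCorank_le_order_padicLFunction W p (f := f))
    (h1 : W.analyticRank = 1) : W.mordellWeilRank = W.analyticRank := by
  obtain ⟨p, hpF, hp5, hgood, hnd⟩ := hOrd W
  obtain ⟨D, hD⟩ := hCan W p hp5 hgood hnd
  haveI : NeZero (W.conductorNorm ℤ) := ⟨(W.conductorNorm_pos_holds).ne'⟩
  obtain ⟨f, hf⟩ := hMod W
  rw [h1]
  exact (soloInformedCM_rank_eq_one hPR hE hBer W hCM h1 p hp5 ⟨hgood, hnd⟩ D hD f hf (hKato p)).1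

end Summit.BirchSwinnertonDyer.BirchSwinnertonDyer.Theorems

end
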